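import Mathlib
import Summits.PneNP.PneNP.Theorems.OverlapGapAlgebraNoStableSection

/-!
# Route OverlapGapAlgebra, crux `SearchHardWindow` (stmt-PneNP-2460): the MACRO-STEP path —
# decomposition `MacroStableValid ⊆ IndepBad ∪ OgpBad`

The Bresler–Huang interpolation path of the crux `NoStableSection` (stmt-PneNP-2462, PROVED by the
line `DartGame`) checks a section `g` at all `k·(m k)+1` splice points. This file starts the proof of
the MACRO-STEP variant: `g` is required to be `ν`-valid only at the CHECKPOINTS `q = i·L`
(`i ≤ ⌈m/L⌉·k`, any block length `L ≥ 1`) of every sweep, and `η n`-stable between CONSECUTIVE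
checkpoints. The ladder extraction of Bresler–Huang Prop. 4.6 (the abstract `stub_ladderExtraction`
of the `DartGame` line) reads the outputs of `g` only where it is told to, so it runs verbatim on the
coarse path `t' ↦ g (instAt Ψ (lin t'))`, `lin t' = (t'/b)·(m k) + min((t' mod b)·L, m k)`,
`b = ⌈m/L⌉·k` checkpoints per sweep, window `W := b`; one window on the coarse clock is exactly one
sweep (`lin (t' + b) = lin t' + m k`), which is what `S_indep` needs.

**Theorem (`mns_ogpBad_of_macro`).** If `g` is `ν`-valid at all checkpoints and `η n`-stable between
consecutive checkpoints of the path `Ψ`, and `Ψ ∉ IndepBad g ν bp`, then `Ψ ∈ OgpBad` — with the SAME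
events `IndepBad`, `OgpBad` of the `DartGame` line, whose counts are already bounded in the tree.
(`…MacroCount.lean` and `…MacroNoStableSection.lean` finish: the macro event has probability
`≤ e^{-cn}` uniformly in `L`.) Purpose: with checkpoints every `L` literals the scan correlation
inequality pays `p^{k²m/L}` instead of `p^{k²m}` for the success probability `p`, which is what turns
the constant-probability low-degree hardness of `…ConstLowDegree.lean` into VANISHING success.

References: G. Bresler, B. Huang, FOCS 2021 / arXiv:2106.02129, Prop. 4.6 [BreslerHuang2022].
-/

namespace Summit.PneNP.PneNP.Theorems

set_option linter.dupNamespace false -- `Summit.PneNP.PneNP.…`: summit = sub-problem (D-0017)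

open Finset Real
open Summit.PneNP.PneNP.Cruxes.NoStableSection.DartGame

section MacroPath

variable {k m n : ℕ}

/-! ### Splice points beyond the end of a sweep -/

/-- Beyond the end of a sweep the splice point is frozen at `Ψ (r+1)`. -/
theorem mns_splice_of_ge (Ψ : PathSp k m n) (r : Fin k) {q : ℕ} (hq : m * k ≤ q) :
    splice Ψ r q = Ψ r.succ := by
  funext a b
  have ha := a.isLt
  have hb := b.isLt
  have h : (a : ℕ) * k + b < q := by
    calc (a : ℕ) * k + b < (a : ℕ) * k + k := by omega
      _ = ((a : ℕ) + 1) * k := by ring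
      _ ≤ m * k := Nat.mul_le_mul_right k ha
      _ ≤ q := hq
  simp [splice, h]

/-- Truncating the offset at `m k` does not change the splice point. -/
theorem mns_splice_min (Ψ : PathSp k m n) (r : Fin k) (q : ℕ) :
    splice Ψ r (min q (m * k)) = splice Ψ r q := by
  rcases le_total q (m * k) with h | h
  · rw [min_eq_left h]
  · rw [min_eq_right h, splice_full, mns_splice_of_ge Ψ r h]

/-! ### The coarse clock -/

/-- The coarse clock: checkpoint index `t' = β·b + i` (`i ≤ b`) is linear time
`β·(m k) + min(i·L, m k)`. -/
theorem mns_lin_rep {b L : ℕ} (hb : 0 < b) (hbL : m * k ≤ b * L) (β i : ℕ) (hi : i ≤ b) :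
    (β * b + i) / b * (m * k) + min ((β * b + i) % b * L) (m * k) =
      β * (m * k) + min (i * L) (m * k) := by
  rcases lt_or_eq_of_le hi with hlt | rfl
  · have h1 : (β * b + i) / b = β := by
      rw [Nat.add_comm, Nat.add_mul_div_right _ _ hb, Nat.div_eq_of_lt hlt, Nat.zero_add]
    have h2 : (β * b + i) % b = i := by
      rw [Nat.add_comm, Nat.add_mul_mod_self_right, Nat.mod_eq_of_lt hlt]
    rw [h1, h2]
  · have h1 : (β * i + i) / i = β + 1 := by
      rw [show β * i + i = (β + 1) * i by ring, Nat.mul_div_cancel _ hb]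
    have h2 : (β * i + i) % i = 0 := by
      rw [show β * i + i = (β + 1) * i by ring, Nat.mul_mod_left]
    rw [h1, h2, Nat.zero_mul, min_eq_left (Nat.zero_le _), min_eq_right hbL]
    ring

/-- **The decomposition for the macro-step path** (Bresler–Huang Prop. 4.6 on the coarse clock).
Let `L ≥ 1`, `b = ⌈m/L⌉·k`. If the section `g` is `ν`-valid at every checkpoint `splice Ψ r (i·L)`,
`i ≤ b`, of every sweep `r`, moves by `≤ η n` between consecutive checkpoints, and `Ψ ∉ IndepBad`,
then `Ψ ∈ OgpBad`: the abstract ladder extraction `stub_ladderExtraction` with window `W := b` applied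
to the coarse path `t' ↦ g (instAt Ψ (lin t'))` and the potential
`h R ℓ v = condEnt (withRung R ℓ v) ℓ` (zero on repeats, `h₂(η)`-Lipschitz per coarse step by
`stub_entropyToolkit`); one coarse window is one sweep, so the jump hypothesis is `¬ IndepBad`.
[BreslerHuang2022, Prop. 4.6] -/
theorem mns_ogpBad_of_macro (hk : 1 ≤ k) (hm : 1 ≤ m) {L : ℕ} (hL : 1 ≤ L)
    {η ν bm bp : ℝ} (hη : 0 ≤ η) (hη2 : η ≤ 1 / 2) (hbm : 0 ≤ bm)
    (hwin : Real.binEntropy η ≤ bp - bm) {g : Inst m k n → Fin n → Bool} {Ψ : PathSp k m n}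
    (hval : ∀ r : Fin k, ∀ i ≤ (m + L - 1) / L * k,
      (violCount (g (splice Ψ r (i * L))) (splice Ψ r (i * L)) : ℝ) ≤ ν * m)
    (hstab : ∀ r : Fin k, ∀ i < (m + L - 1) / L * k,
      (hammingDist (g (splice Ψ r (i * L))) (g (splice Ψ r ((i + 1) * L))) : ℝ) ≤ η * n)
    (hI : ¬ IndepBad g ν bp Ψ) : OgpBad k m n ν bm bp Ψ := by
  classical
  -- the block bookkeeping
  set m' : ℕ := (m + L - 1) / L with hm'
  set b : ℕ := m' * k with hbdef
  have hL0 : 0 < L := hL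
  have hm'1 : 1 ≤ m' := by
    rw [hm']
    exact (Nat.le_div_iff_mul_le hL0).2 (by omega)
  have hm'L : m ≤ m' * L := by
    rw [hm']
    have h := Nat.div_add_mod (m + L - 1) L
    have h2 : (m + L - 1) % L < L := Nat.mod_lt _ hL0
    have h3 : L * ((m + L - 1) / L) = (m + L - 1) / L * L := Nat.mul_comm _ _
    omega
  have hb : 0 < b := Nat.mul_pos (by omega) (by omega)
  have hbL : m * k ≤ b * L := by
    calc m * k ≤ m' * L * k := Nat.mul_le_mul_right k hm'L
      _ = b * L := by rw [hbdef]; ring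
  have hW : 0 < m * k := Nat.mul_pos (by omega) (by omega)
  -- the coarse clock and the coarse path
  set lin : ℕ → ℕ := fun t' => t' / b * (m * k) + min (t' % b * L) (m * k) with hlin
  have hlin_rep : ∀ β i, i ≤ b → lin (β * b + i) = β * (m * k) + min (i * L) (m * k) :=
    fun β i hi => mns_lin_rep hb hbL β i hi
  -- every index is `β b + i` with `i < b`
  have hdecomp : ∀ t' : ℕ, ∃ β i, i < b ∧ t' = β * b + i := fun t' =>
    ⟨t' / b, t' % b, Nat.mod_lt _ hb, by rw [Nat.mul_comm, Nat.div_add_mod]⟩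
  have hlin_succ : ∀ β i, i < b → lin (β * b + i + 1) = β * (m * k) + min ((i + 1) * L) (m * k) := by
    intro β i hi
    rw [add_assoc]
    exact hlin_rep β (i + 1) hi
  have hlin_mono : Monotone lin := by
    refine monotone_nat_of_le_succ fun t' => ?_
    obtain ⟨β, i, hi, rfl⟩ := hdecomp t'
    rw [hlin_rep β i hi.le, hlin_succ β i hi]
    exact Nat.add_le_add_left (min_le_min_right _ (Nat.mul_le_mul_right L (Nat.le_succ i))) _
  have hlin_add : ∀ t', lin (t' + b) = lin t' + m * k := by
    intro t'
    obtain ⟨β, i, hi, rfl⟩ := hdecomp t'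
    rw [show β * b + i + b = (β + 1) * b + i by ring, hlin_rep (β + 1) i hi.le, hlin_rep β i hi.le]
    ring
  have hlin_kb : lin (k * b) = k * (m * k) := by
    have := hlin_rep k 0 (Nat.zero_le _)
    rw [Nat.add_zero, Nat.zero_mul, min_eq_left (Nat.zero_le _), Nat.add_zero] at this
    exact this
  have hlin_le : ∀ t' ≤ k * b, lin t' ≤ k * (m * k) := fun t' ht' =>
    (hlin_mono ht').trans hlin_kb.le
  -- the instances read on the coarse clock are checkpoints
  have hinst : ∀ β i, β < k → i ≤ b → ∀ hβ : β < k,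
      instAt Ψ (lin (β * b + i)) = splice Ψ ⟨β, hβ⟩ (i * L) := by
    intro β i _ hi hβ
    rw [hlin_rep β i hi, instAt_eq_splice Ψ ⟨β, hβ⟩ (min_le_right _ _), mns_splice_min]
  -- validity at every coarse time `t' ≤ k b`
  have hvalid : ∀ t' ≤ k * b,
      (violCount (g (instAt Ψ (lin t'))) (instAt Ψ (lin t')) : ℝ) ≤ ν * m := by
    intro t' ht'
    rcases lt_or_eq_of_le ht' with hlt | rfl
    · obtain ⟨β, i, hi, rfl⟩ := hdecomp t'
      have hβ : β < k := by
        by_contra hβ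
        push Not at hβ
        have : k * b ≤ β * b := Nat.mul_le_mul_right b hβ
        omega
      rw [hinst β i hβ hi.le hβ]
      exact hval ⟨β, hβ⟩ i hi.le
    · -- the endpoint: `lin (k b) = k (m k)`, read as checkpoint `b` of the last sweep
      have hk1 : k - 1 < k := by omega
      have heq : k * b = (k - 1) * b + b := by
        rw [show k * b = (k - 1 + 1) * b by rw [Nat.sub_add_cancel hk]]; ring
      rw [heq, hinst (k - 1) b hk1 le_rfl hk1]
      exact hval ⟨k - 1, hk1⟩ b le_rfl
  -- stability along the coarse clock
  have hstable : ∀ t' < k * b,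
      (hammingDist (g (instAt Ψ (lin t'))) (g (instAt Ψ (lin (t' + 1)))) : ℝ) ≤ η * n := by
    intro t' ht'
    obtain ⟨β, i, hi, rfl⟩ := hdecomp t'
    have hβ : β < k := by
      by_contra hβ
      push Not at hβ
      have : k * b ≤ β * b := Nat.mul_le_mul_right b hβ
      omega
    rw [hinst β i hβ hi.le hβ, hlin_succ β i hi, instAt_eq_splice Ψ ⟨β, hβ⟩ (min_le_right _ _),
      mns_splice_min]
    exact hstab ⟨β, hβ⟩ i hi
  -- the data of the abstract extraction
  set x : ℕ → (Fin n → Bool) := fun t' => g (instAt Ψ (lin t')) with hx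
  set hpot : (ℕ → (Fin n → Bool)) → ℕ → (Fin n → Bool) → ℝ :=
    fun R ℓ v => condEnt (withRung R ℓ v) ℓ with hhpot
  have hB : EntropyToolkit := stub_entropyToolkit
  -- Lipschitz step
  have hlip : ∀ (R : ℕ → Fin n → Bool) (ℓ t' : ℕ), t' < k * b →
      |hpot R ℓ (x (t' + 1)) - hpot R ℓ (x t')| ≤ Real.binEntropy η := by
    intro R ℓ t' ht'
    have hd := hstable t' ht'
    rcases Nat.eq_zero_or_pos n with hn | hn
    · subst hn
      have : x (t' + 1) = x t' := funext fun i => i.elim0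
      rw [this, sub_self, abs_zero]
      exact Real.binEntropy_nonneg hη (by linarith)
    have hnr : (0 : ℝ) < n := by exact_mod_cast hn
    have hdn : (hammingDist (x (t' + 1)) (x t') : ℝ) / n ≤ η := by
      rw [div_le_iff₀ hnr, hammingDist_comm]; exact hd
    have hd2 : (hammingDist (x (t' + 1)) (x t') : ℝ) ≤ n / 2 := by
      rw [hammingDist_comm]
      calc (hammingDist (x t') (x (t' + 1)) : ℝ) ≤ η * n := hd
        _ ≤ 1 / 2 * n := mul_le_mul_of_nonneg_right hη2 hnr.le
        _ = n / 2 := by ring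
    calc |hpot R ℓ (x (t' + 1)) - hpot R ℓ (x t')|
        ≤ Real.binEntropy ((hammingDist (x (t' + 1)) (x t') : ℝ) / n) := hB.2 n ℓ R _ _ hd2
      _ ≤ Real.binEntropy η := by
          refine Real.binEntropy_strictMonoOn.monotoneOn ⟨by positivity, ?_⟩ ⟨hη, ?_⟩ hdn
          · exact hdn.trans (by linarith)
          · linarith
  -- the jump one coarse window (= one sweep) later (`S_indep`)
  have hjump : ∀ (ℓ : ℕ) (ts : ℕ → ℕ) (t' : ℕ), 1 ≤ ℓ → ℓ ≤ k → (∀ j < ℓ, ts j + b ≤ t') →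
      t' ≤ k * b → bp < hpot (fun j => x (ts j)) ℓ (x t') := by
    intro ℓ ts t' _ hℓk hts ht'
    by_contra hle
    push Not at hle
    apply hI
    refine ⟨⟨ℓ, Nat.lt_succ_of_le hℓk⟩, lin t', fun j => lin (ts j), x t', hlin_le t' ht',
      fun j => ?_, hvalid t' ht', ?_⟩
    · calc lin (ts j) + m * k = lin (ts j + b) := (hlin_add _).symm
        _ ≤ lin t' := hlin_mono (hts j j.isLt)
    · have hR : withRung (seqOf fun j : Fin ℓ => g (instAt Ψ (lin (ts j)))) ℓ (x t') =
          withRung (fun j => x (ts j)) ℓ (x t') :=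
        withRung_congr (fun j hj => by rw [seqOf_apply_lt _ hj]) _
      simpa [hhpot, hR] using hle
  -- run the extraction on the coarse clock, window `b`
  obtain ⟨ts, hts0, hgap, hrung⟩ := stub_ladderExtraction (Fin n → Bool) k b x hpot
    (Real.binEntropy η) bm bp hb hbm hwin (fun R R' ℓ v hRR' => condEnt_withRung_congr hRR' v)
    (fun R ℓ v hv => hB.1 n ℓ R v hv) hlip hjump
  -- coarse times are bounded by `ℓ · b`
  have hbound : ∀ ℓ ≤ k, ts ℓ ≤ ℓ * b := by
    intro ℓ hℓ
    induction ℓ with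
    | zero => simp [hts0]
    | succ ℓ ih =>
      calc ts (ℓ + 1) ≤ ts ℓ + b := (hgap ℓ (by omega)).2
        _ ≤ ℓ * b + b := Nat.add_le_add_right (ih (by omega)) _
        _ = (ℓ + 1) * b := by ring
  have hmono : ∀ i j, i ≤ j → j ≤ k → ts i ≤ ts j := by
    intro i j hij hjk
    induction j with
    | zero => simp [Nat.le_zero.1 hij]
    | succ j ih =>
      rcases Nat.lt_or_eq_of_le hij with h | h
      · exact (ih (Nat.lt_succ_iff.1 h) (by omega)).trans (hgap j (by omega)).1.le
      · rw [h]
  refine ⟨fun ℓ => lin (ts ℓ), fun ℓ => x (ts ℓ), ?_, ?_, ?_, ?_⟩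
  · intro i j hij
    exact hlin_mono (hmono i j hij (Nat.lt_succ_iff.1 j.isLt))
  · simpa using hlin_le _ ((hbound k le_rfl).trans_eq rfl)
  · intro ℓ
    exact hvalid _ ((hbound ℓ (Nat.lt_succ_iff.1 ℓ.isLt)).trans
      (Nat.mul_le_mul_right _ (Nat.lt_succ_iff.1 ℓ.isLt)))
  · intro ℓ hℓ1
    have hℓk : (ℓ : ℕ) ≤ k := Nat.lt_succ_iff.1 ℓ.isLt
    have hmem := hrung ℓ hℓ1 hℓk
    have hY : condEnt (seqOf fun ℓ' : Fin (k + 1) => x (ts ℓ')) ℓ =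
        hpot (fun j => x (ts j)) ℓ (x (ts ℓ)) := by
      simp only [hhpot]
      refine condEnt_congr fun j hj => ?_
      rw [seqOf_apply_lt _ (by omega : j < k + 1)]
      rcases Nat.lt_or_eq_of_le hj with hj' | rfl
      · rw [withRung_of_lt _ _ _ hj']
      · rw [withRung_self]
    rw [hY]
    exact hmem

end MacroPath

end Summit.PneNP.PneNP.Theorems
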